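import Literature.Geometry.Symplectic.AlmostComplexStructure
import Literature.Geometry.Symplectic.JHolomorphicMap
import Literature.Topology.FourManifolds.ComplexProjectiveSpace
import Mathlib.Geometry.Manifold.Instances.Sphere
import Mathlib.Topology.Homotopy.Basic
import Mathlib.Topology.CompactOpen
import Literature.Topology.FourManifolds.ComplexProjectiveSpaceCohomology
import Literature.Geometry.Kaehler.ManifoldForms
import Literature.Geometry.Symplectic.PlusOneSpherePairProofs

/-!
# DRAFT (lead c3, NOT proposed): Lean statements of the two analytic named facts the core
`stub_biFoliationCore` needs, over the line's landed two-chart-sphere vocabulary.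
See `Lines/cross-cap-laurent-core-c3.md` §4. For the planner of the promoted item.
-/

open scoped Manifold ContDiff Topology
open Set Function Literature.Geometry.Symplectic Literature.Topology.FourManifolds
  Literature.Topology.FourManifolds.ComplexProjectiveSpace Literature.Geometry.Kaehler
  Literature.AlgebraicTopology.SingularHomology

namespace Draft

/-- **(F1+) Local foliation by embedded `J`-spheres with trivial normal bundle, with the positivity
uniqueness clause** (Wendl 2018, Prop. 2.53 (m = 0) (1)–(2) with Thm. 2.49; Hofer–Lizan–Sikorav 1997,
Thm. 1; McDuff 1991). Almost complex 4-manifold `(X, JX)` (no symplectic form); `S = (u₀, v₀)` an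
embedded `JX`-holomorphic two-chart sphere whose image `Σ := range u₀ ∪ {v₀ 0}` has a TRIVIAL NORMAL
BUNDLE, expressed as: an open `N ⊇ Σ` and a smooth submersion `π : N → ℂ` with `Σ = N ∩ π⁻¹ 0`.
Conclusion: a jointly smooth 1-complex-parameter family `(U a, V a)`, `‖a‖ < ε`, of embedded
`JX`-spheres through `S = (U 0, V 0)`, pairwise disjoint, sweeping out an open neighbourhood `N'` of
`Σ` diffeomorphically (injective with injective differentials), and UNIQUENESS BY POSITIVITY: every
`JX`-sphere whose glued map `ℂℙ¹ → X` is homotopic to that of `S` and whose image meets `N'` has the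
image of a leaf. [cite: Wendl2018, Prop. 2.53 and Thm. 2.49] [cite: HoferLizanSikorav1997, Thm. 1] -/
def hls_localFoliation_embeddedSphere_trivialNormal : Prop :=
  ∀ (X : Type) [TopologicalSpace X] [T2Space X] [SecondCountableTopology X]
    [ChartedSpace (EuclideanSpace ℝ (Fin 4)) X] [IsManifold (𝓡 4) ∞ X]
    (JX : AlmostComplexStructure (𝓡 4) ∞ X) (u₀ v₀ : ℂ → X) (N : Set X) (π : X → ℂ),
    -- `S = (u₀, v₀)` is an embedded `JX`-holomorphic two-chart sphere
    ContMDiff 𝓘(ℝ, ℂ) (𝓡 4) ∞ u₀ → ContMDiff 𝓘(ℝ, ℂ) (𝓡 4) ∞ v₀ → (∀ z : ℂ, z ≠ 0 → v₀ z = u₀ z⁻¹) →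
    IsJHolomorphic (𝓡 4) (fun y => JX y) u₀ → IsJHolomorphic (𝓡 4) (fun y => JX y) v₀ →
    Injective u₀ → (∀ z, Injective (mfderiv 𝓘(ℝ, ℂ) (𝓡 4) u₀ z)) →
    Injective (mfderiv 𝓘(ℝ, ℂ) (𝓡 4) v₀ 0) → v₀ 0 ∉ range u₀ →
    -- trivial normal bundle: `Σ = N ∩ π⁻¹ 0` for a submersion `π` on the open `N`
    IsOpen N → range u₀ ∪ {v₀ 0} ⊆ N → ContMDiffOn (𝓡 4) 𝓘(ℝ, ℂ) ∞ π N →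
    (∀ y ∈ N, Surjective (mfderiv (𝓡 4) 𝓘(ℝ, ℂ) π y)) →
    {y | y ∈ N ∧ π y = 0} = range u₀ ∪ {v₀ 0} →
    ∃ (ε : ℝ) (U V : ℂ → ℂ → X), 0 < ε ∧
      -- through `S`
      (∀ z, U 0 z = u₀ z) ∧ (∀ w, V 0 w = v₀ w) ∧
      -- each leaf is an embedded `JX`-sphere
      (∀ a : ℂ, ‖a‖ < ε →
        ContMDiff 𝓘(ℝ, ℂ) (𝓡 4) ∞ (U a) ∧ ContMDiff 𝓘(ℝ, ℂ) (𝓡 4) ∞ (V a) ∧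
        (∀ z : ℂ, z ≠ 0 → V a z = U a z⁻¹) ∧
        IsJHolomorphic (𝓡 4) (fun y => JX y) (U a) ∧ IsJHolomorphic (𝓡 4) (fun y => JX y) (V a) ∧
        Injective (U a) ∧ (∀ z, Injective (mfderiv 𝓘(ℝ, ℂ) (𝓡 4) (U a) z)) ∧
        Injective (mfderiv 𝓘(ℝ, ℂ) (𝓡 4) (V a) 0) ∧ V a 0 ∉ range (U a)) ∧
      -- jointly smooth in `(a, z)`
      ContMDiffOn 𝓘(ℝ, ℂ × ℂ) (𝓡 4) ∞ (fun q : ℂ × ℂ => U q.1 q.2) (Metric.ball 0 ε ×ˢ univ) ∧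
      ContMDiffOn 𝓘(ℝ, ℂ × ℂ) (𝓡 4) ∞ (fun q : ℂ × ℂ => V q.1 q.2) (Metric.ball 0 ε ×ˢ univ) ∧
      -- the leaves are pairwise disjoint and sweep out an open set diffeomorphically
      (∀ a a' : ℂ, ‖a‖ < ε → ‖a'‖ < ε → a ≠ a' →
        Disjoint (range (U a) ∪ {V a 0}) (range (U a') ∪ {V a' 0})) ∧
      (∀ q ∈ Metric.ball (0 : ℂ) ε ×ˢ (univ : Set ℂ),
        Injective (mfderiv 𝓘(ℝ, ℂ × ℂ) (𝓡 4) (fun q : ℂ × ℂ => U q.1 q.2) q) ∧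
        Injective (mfderiv 𝓘(ℝ, ℂ × ℂ) (𝓡 4) (fun q : ℂ × ℂ => V q.1 q.2) q)) ∧
      IsOpen (⋃ a ∈ Metric.ball (0 : ℂ) ε, (range (U a) ∪ {V a 0})) ∧
      -- uniqueness by positivity: a homotopic `JX`-sphere meeting the swept set is a leaf
      (∀ (u v : ℂ → X) (F F₀ : C(ComplexProjectiveSpace 1, X)),
        ContMDiff 𝓘(ℝ, ℂ) (𝓡 4) ∞ u → ContMDiff 𝓘(ℝ, ℂ) (𝓡 4) ∞ v → (∀ z : ℂ, z ≠ 0 → v z = u z⁻¹) →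
        IsJHolomorphic (𝓡 4) (fun y => JX y) u → IsJHolomorphic (𝓡 4) (fun y => JX y) v →
        (∀ p, CoordNeZero 0 p → F p = u (affineCoordComplex 0 p 0)) →
        (∀ p, CoordNeZero 1 p → F p = v (affineCoordComplex 1 p 0)) →
        (∀ p, CoordNeZero 0 p → F₀ p = u₀ (affineCoordComplex 0 p 0)) →
        (∀ p, CoordNeZero 1 p → F₀ p = v₀ (affineCoordComplex 1 p 0)) →
        F.Homotopic F₀ →
        (∃ z a, ‖a‖ < ε ∧ u z ∈ range (U a) ∪ {V a 0}) →
        ∃ a, ‖a‖ < ε ∧ range u ∪ {v 0} = range (U a) ∪ {V a 0})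

/-- **(F2+) Gromov compactness for `J`-spheres in a fixed homotopy class, dichotomy form**
(Gromov 1985, 1.5.B; McDuff–Salamon 2012, Thm. 5.3.1 with Thm. 4.6.1 and stability (Def. 5.1.1);
Wendl 2018, §4.1–4.2 / Thm. 4.6 in dimension 4; Hummel 1997, Ch. V). `X` a compact 4-manifold, `JX`
tamed by a closed smooth 2-form `ωX`, `(uₙ, vₙ)` a sequence of `JX`-holomorphic two-chart spheres
whose glued maps `Fₙ : ℂℙ¹ → X` are all homotopic to a fixed `F₀` (so the energy is constant).
Then, after passing to a subsequence `φ`, EITHER (A) there are linear reparametrisations `A k` of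
`ℂℙ¹` and a `JX`-sphere `(u, v)` with glued map `F` such that `F_{φ k} ∘ [A k] → F` uniformly
(compact-open topology on `C(ℂℙ¹, X)`), OR (B) the energy splits: there are `m ≥ 2` NON-CONSTANT
`JX`-spheres `B₁, …, Bₘ` (the non-constant components of the limit stable tree) whose glued maps'
fundamental classes add up to that of the `Fₙ` in `H₂(X; ℤ)`, and whose images attract the images
of the `u_{φ k}` (every neighbourhood of `⋃ⱼ im Bⱼ` eventually contains `im u_{φ k}`, and every
point of `⋃ⱼ im Bⱼ` is a limit of points of `im u_{φ k}`). Homology classes via the tree's glued maps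
and `ComplexProjectiveSpace.homologicalOrientationInt 1`. DRAFT — the two-chart bookkeeping of the
components is as in (F1+). [cite: McDuffSalamon2012, Thm. 5.3.1] [cite: Gromov1985, 1.5.B] -/
def gromovCompactness_spheres_dichotomy : Prop :=
  ∀ (X : Type) [TopologicalSpace X] [T2Space X] [SecondCountableTopology X] [CompactSpace X]
    [ChartedSpace (EuclideanSpace ℝ (Fin 4)) X] [IsManifold (𝓡 4) ∞ X]
    (ωX : MForm (𝓡 4) X ℝ 2) (JX : AlmostComplexStructure (𝓡 4) ∞ X)
    (us vs : ℕ → ℂ → X) (Fs : ℕ → C(ComplexProjectiveSpace 1, X)) (F₀ : C(ComplexProjectiveSpace 1, X)),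
    IsSmoothForm ωX → IsClosedForm ωX → JX.IsTamedBy ωX →
    (∀ n, ContMDiff 𝓘(ℝ, ℂ) (𝓡 4) ∞ (us n) ∧ ContMDiff 𝓘(ℝ, ℂ) (𝓡 4) ∞ (vs n) ∧
      (∀ z : ℂ, z ≠ 0 → vs n z = us n z⁻¹) ∧
      IsJHolomorphic (𝓡 4) (fun y => JX y) (us n) ∧ IsJHolomorphic (𝓡 4) (fun y => JX y) (vs n) ∧
      (∀ p, CoordNeZero 0 p → Fs n p = us n (affineCoordComplex 0 p 0)) ∧
      (∀ p, CoordNeZero 1 p → Fs n p = vs n (affineCoordComplex 1 p 0)) ∧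
      (Fs n).Homotopic F₀) →
    ∃ φ : ℕ → ℕ, StrictMono φ ∧
     ((-- (A) convergence modulo reparametrisation, no energy loss
       ∃ (u v : ℂ → X) (F : C(ComplexProjectiveSpace 1, X))
         (A : ℕ → ((Fin 2 → ℂ) ≃ₗ[ℂ] (Fin 2 → ℂ))),
         ContMDiff 𝓘(ℝ, ℂ) (𝓡 4) ∞ u ∧ ContMDiff 𝓘(ℝ, ℂ) (𝓡 4) ∞ v ∧
         (∀ z : ℂ, z ≠ 0 → v z = u z⁻¹) ∧
         IsJHolomorphic (𝓡 4) (fun y => JX y) u ∧ IsJHolomorphic (𝓡 4) (fun y => JX y) v ∧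
         (∀ p, CoordNeZero 0 p → F p = u (affineCoordComplex 0 p 0)) ∧
         (∀ p, CoordNeZero 1 p → F p = v (affineCoordComplex 1 p 0)) ∧
         Filter.Tendsto (fun k => (Fs (φ k)).comp
           ⟨PlusOneSpherePair.projectiveMap (A k), PlusOneSpherePair.continuous_projectiveMap (A k)⟩) Filter.atTop (𝓝 F)) ∨
      (-- (B) the energy splits into `m ≥ 2` non-constant pieces representing the same class
       ∃ (m : ℕ) (Bu Bv : Fin m → ℂ → X) (G : Fin m → C(ComplexProjectiveSpace 1, X)), 2 ≤ m ∧
         (∀ j, ContMDiff 𝓘(ℝ, ℂ) (𝓡 4) ∞ (Bu j) ∧ ContMDiff 𝓘(ℝ, ℂ) (𝓡 4) ∞ (Bv j) ∧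
           (∀ z : ℂ, z ≠ 0 → Bv j z = Bu j z⁻¹) ∧
           IsJHolomorphic (𝓡 4) (fun y => JX y) (Bu j) ∧ IsJHolomorphic (𝓡 4) (fun y => JX y) (Bv j) ∧
           (∃ z, Bu j z ≠ Bu j 0) ∧
           (∀ p, CoordNeZero 0 p → G j p = Bu j (affineCoordComplex 0 p 0)) ∧
           (∀ p, CoordNeZero 1 p → G j p = Bv j (affineCoordComplex 1 p 0))) ∧
         (∀ n, ∑ j, singularHomology.map ℤ ℤ (G j) (2 * 1)
             (ComplexProjectiveSpace.homologicalOrientationInt 1).fundamentalClass =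
           singularHomology.map ℤ ℤ (Fs n) (2 * 1)
             (ComplexProjectiveSpace.homologicalOrientationInt 1).fundamentalClass) ∧
         (∀ O : Set X, IsOpen O → (⋃ j, (range (Bu j) ∪ {Bv j 0})) ⊆ O →
           ∀ᶠ k in Filter.atTop, range (us (φ k)) ∪ {vs (φ k) 0} ⊆ O) ∧
         (∀ y ∈ ⋃ j, (range (Bu j) ∪ {Bv j 0}), ∀ O' : Set X, IsOpen O' → y ∈ O' →
           ∀ᶠ k in Filter.atTop, ((range (us (φ k)) ∪ {vs (φ k) 0}) ∩ O').Nonempty)))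


end Draft
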